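import Summits.QuantumFields.YangMills.Theorems.BalabanUVNodesN18KingModelOneRun
import Summits.QuantumFields.YangMills.Theorems.BalabanUVNodesN18KingModelTorusDeriv

/-!
# BalabanUVNodes ∕ N18 — (0.25) FOR THE DERIVATIVE ROW: the one-run envelopes `DecayBound` with `κ > 0` of King's (3.73)
# SECOND-bound graphs `Σ_{z,w} ∂^η_μℋ_j(x_A, z)·C^{(j)}(z, w)·ℋ_j(y_A, w)` on Bałaban's tori, at ONE letter set with their `NE5`
# (p418964), and PER LINE (Track A, DAG node N18 = NE5 `T4OutputRate.NE5 EA EB W κ θ C₅` :211; director-ym R134 row n18 s3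
# «King-model transfer `N18KingModelTorus` (κ, C₅ from (d, L, a, m², γ)) → `TwoRunTorusNE5Final*`», module 9 of seat
# pub-ymgap-dag-n18-e; the derivative-row twin of 5a `N18KingModelOneRun` ∕ 5b §3)

HONEST FRAMING.  Count-neutral kernel bookkeeping (seat pub-ymgap-dag-n18-e g5, strategy s3; `--supports` K3′
`SpineGivenEndpointR12`, helper).  King's `A = 0` scalar MODEL ([King1986], printed and proved, typed by seats n18-a∕n18-b) —
NOT Bałaban's covariant one-step outputs `E^{(j)}(X; g, U_k(V))` of [Balaban1987RG1] (0.24)∕(2.13), for which NE5 is NOT IN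
PRINT and has no tree producer (NODE O instance 0∕1); NOT a node discharge; finite tori; nothing continuum ∕ ℝ⁴ ∕ OS ∕
mass-gap ∕ Clay.  THEOREMS ONLY: 0 `def`, 0 `sorry`, standard axioms.

THE POINT.  n18-a's p418964 `N18KingModelTorusDeriv.ne5_kingModel_threeFactorDeriv_torus` typed King's (3.73) SECOND bound
(the `∂_μ` row: run A reads `L^j·(ℋ_j(x_A + e_μ, ·) − ℋ_j(x_A, ·))`, run B `L^nL^j·(ℋ_{j+n}(x_B + e_μ, ·) − ℋ_{j+n}(x_B, ·))`) as a
multi-scale `NE5` inhabitant (`γ < 1`); modules 5a∕5b typed (0.25) for the FIRST-bound graphs only (the seat's census (iv)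
«derivative ∕ Hölder rows» open).  THIS FILE is the derivative-row twin of 5a §2 and 5b §3:
* §1 **`decayBound_kingModel_threeFactorDeriv_torus`** — on p418964's binder list VERBATIM (`dir : C.Dom → Fin d`), `∃ κ > 0, A ≥ 0`
  ((d, L, a, m²) only; γ-free) with `DecayBound EA W A κ ∧ DecayBound EB W A κ` — Theorem 3.3's DERIVATIVE clause for the row
  (n18-b `dminimiser_row_decay`, `King1986/MinimizerTwoSpacingDeriv`), Theorem 3.3 for the column (`minimiser_col_decay` ∘
  `blockOf_over`), (4.34) for the middle (`king_cov_decay_torus`), lattice sums `tdistT_sumBound`, convolved by 5a §1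
  `decayBound_of_threeFactorDecay`.
* §2 **`kingModel_threeFactorDeriv_printedPair_torus`** — ONE LETTER SET (`γ < 1`): `DecayBound EA W A κ ∧ DecayBound EB W A κ ∧
  NE5 EA EB W κ (L^{−γ∕2}) C₅` (p418964 brought to the common `κ` by `N18Knit.ne5_mono`, §1 by 5a `decayBound_mono`).
* §3 (per line, any index type `l` with King scale `s_l ≥ 1`, direction `μ_l`, readings under readings)
  **`abs_kingGraphDeriv_le_of_readings`** (`|G^∂_A(l)|, |G^∂_B(l)| ≤ A·e^{−κ|B(x_A l) − B(y_A l)|_{T₁}}`) and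
  **`abs_kingGraphDeriv_sub_le_of_readings`** (`|G^∂_A(l) − G^∂_B(l)| ≤ C₅·(L^{−γ∕2})^{s_l}·e^{−κ|B(x_A l) − B(y_A l)|_{T₁}}`) — the
  per-line inputs with which modules 5c∕7 compose verbatim for derivative insertions.
WHAT THIS DOES NOT DO.  The Hölder rows (3–4) of (3.73) (`…TorusHolder*`, extra points) and the top piece are not treated;
`A = 0`, `g`∕`U` unread; (2.20)-rescaling outside; NOT Bałaban's `E^{(j)}(X; g, U)`.

Sources: C. King, Commun. Math. Phys. **102** (1986) 649–677 [King1986] — Thm 3.3 (3.7) p. 658, Prop. 3.8 (3.71) p. 664, Prop. 3.9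
(3.73) p. 665, (4.34) p. 674, (4.41)–(4.43) p. 675; T. Bałaban, Commun. Math. Phys. **109** (1987) 249–301 [Balaban1987RG1] —
(0.24)–(0.25) p. 257, (1.18) p. 263.  No claim about the mass gap.
-/

noncomputable section

namespace Summit.QuantumFields.YangMills.BalabanUVNodes.N18KingModelDerivOneRun

open Real Matrix
open Literature.MathematicalPhysics.QuantumFieldTheory.Balaban1983to89 (Params)
open Literature.MathematicalPhysics.QuantumFieldTheory.Balaban1983to89
open Literature.MathematicalPhysics.QuantumFieldTheory.Balaban1983to89.T4OutputRate (Carriers Functional NE5 DecayBound)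
open Literature.MathematicalPhysics.QuantumFieldTheory.Balaban1983to89.B5Prop11Plancherel (Tor fine unitVec)
open Literature.MathematicalPhysics.QuantumFieldTheory.Balaban1983to89.B4Sect5Proof (latticeConst latticeConst_nonneg)
open Literature.MathematicalPhysics.QuantumFieldTheory.King1986 (aK exp_decay_mono)
open Literature.MathematicalPhysics.QuantumFieldTheory.King1986.Torus
  (minimiser effLaplacian blockProj blockOf blockOf_over tdistT tdistT_nonneg tdistT_isPseudoDist tdistT_sumBound
    gam0L gam0L_pos kapCT kapCT_pos_le aminL_le_aK minimiser_col_decay dminimiser_row_decay)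
open Summit.QuantumFields.YangMills.BalabanUVNodes.N18KingModel (kingTheta_pos)
open Summit.QuantumFields.YangMills.BalabanUVNodes.N18KingModelScales (king_cov_decay_torus)
open Summit.QuantumFields.YangMills.BalabanUVNodes.N18KingModelTorusDeriv (ne5_kingModel_threeFactorDeriv_torus)
open Summit.QuantumFields.YangMills.BalabanUVNodes.N18KingModelOneRun (decayBound_mono decayBound_of_threeFactorDecay)
open Summit.QuantumFields.YangMills.BalabanUVNodes.N18Knit (ne5_mono)

variable {d : ℕ}

/-! ## §1 (0.25) for the derivative-row graphs of both runs -/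

/-- **(0.25) WITH DECAY FOR KING'S DERIVATIVE-ROW GRAPHS ON BAŁABAN'S TORI — UNCONDITIONAL.**  For `d ≥ 1`, odd `L > 1`, `a > 0`,
`m² > 0` there are `κ > 0`, `A ≥ 0` (functions of `d, L, a, m²` ONLY) such that on p418964's binder list VERBATIM (volumes,
carriers with `1 ≤ scale X` and a direction `dir X`, run-A readings under run-B readings, `d X ≤ |B(x_A) − B(y_A)|_{T₁}`, the two
functionals reading `Σ_{z,w} L^j(ℋ_j(x_A + e_{dir X}, z) − ℋ_j(x_A, z))·C^{(j)}(z, w)·ℋ_j(y_A, w)` and its run-B twin on level `j + n`,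
King's ACTUAL `A = 0` operators): `DecayBound EA W A κ ∧ DecayBound EB W A κ`.  5a §1 twice; rows `dminimiser_row_decay`
(Theorem 3.3's derivative clause in block distance), columns `minimiser_col_decay` (∘ `blockOf_over`), middle
`king_cov_decay_torus`, sums `tdistT_sumBound`; `κ = ½·min(δ₀^{∂row}, δ₀^{col}, κ′)`.
[cite: King1986, Thm 3.3 (3.7) p.658, (4.34) p.674, (4.41)–(4.42) p.675, Prop. 3.9 (3.73) p.665; Balaban1987RG1, (0.25) p.257] -/
theorem decayBound_kingModel_threeFactorDeriv_torus (hd : 1 ≤ d) (L : ℕ) [NeZero L] (hLp : Odd L ∧ 1 < L) {a m2 : ℝ}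
    (ha : 0 < a) (hm : 0 < m2) :
    ∃ κ A : ℝ, 0 < κ ∧ 0 ≤ A ∧
      ∀ (n : ℕ) (_hn : 1 ≤ n) (M : ℕ → Fin d → ℕ) [∀ j μ, NeZero (M j μ)]
        (_hM : ∀ j, ∃ mm : ℕ, ∀ μ, L * M j μ = 2 * L ^ mm)
        (C : Carriers) (_hsc : ∀ X, 1 ≤ C.scale X) (dir : C.Dom → Fin d)
        (xA yA : (X : C.Dom) → Tor (fine (L ^ C.scale X) (fine L (M (C.scale X)))))
        (xB yB : (X : C.Dom) → Tor (fine (L ^ n * L ^ C.scale X) (fine L (M (C.scale X)))))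
        (_hx : ∀ X μ, (xA X μ).val = (xB X μ).val / L ^ n)
        (_hy : ∀ X μ, (yA X μ).val = (yB X μ).val / L ^ n)
        (_hd : ∀ X, C.d X ≤ tdistT (fine L (M (C.scale X)))
            (blockOf (L ^ C.scale X) (fine L (M (C.scale X))) (xA X))
            (blockOf (L ^ C.scale X) (fine L (M (C.scale X))) (yA X)))
        (EA : Functional C C.BgA) (EB : Functional C C.BgB)
        (_hEA : ∀ g U X, EA g U X =
          (fun z => ((L ^ C.scale X : ℕ) : ℝ)
              * (minimiser (L ^ C.scale X) (fine L (M (C.scale X))) (aK a L (C.scale X))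
                    (((L ^ C.scale X : ℕ) : ℝ) ^ 2) m2 (Pi.single z 1)
                    (xA X + unitVec (fine (L ^ C.scale X) (fine L (M (C.scale X)))) (dir X))
                  - minimiser (L ^ C.scale X) (fine L (M (C.scale X))) (aK a L (C.scale X))
                    (((L ^ C.scale X : ℕ) : ℝ) ^ 2) m2 (Pi.single z 1) (xA X)))
            ⬝ᵥ ((effLaplacian (L ^ C.scale X) (fine L (M (C.scale X))) (aK a L (C.scale X))
                    (((L ^ C.scale X : ℕ) : ℝ) ^ 2) m2
                  + (a * ((L : ℝ) ^ 2)⁻¹) • blockProj L (M (C.scale X)))⁻¹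
                *ᵥ fun w => minimiser (L ^ C.scale X) (fine L (M (C.scale X))) (aK a L (C.scale X))
                    (((L ^ C.scale X : ℕ) : ℝ) ^ 2) m2 (Pi.single w 1) (yA X)))
        (_hEB : ∀ g U X, EB g U X =
          (fun z => ((L ^ n * L ^ C.scale X : ℕ) : ℝ)
              * (minimiser (L ^ n * L ^ C.scale X) (fine L (M (C.scale X))) (aK a L (C.scale X + n))
                    (((L ^ n * L ^ C.scale X : ℕ) : ℝ) ^ 2) m2 (Pi.single z 1)
                    (xB X + unitVec (fine (L ^ n * L ^ C.scale X) (fine L (M (C.scale X)))) (dir X))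
                  - minimiser (L ^ n * L ^ C.scale X) (fine L (M (C.scale X))) (aK a L (C.scale X + n))
                    (((L ^ n * L ^ C.scale X : ℕ) : ℝ) ^ 2) m2 (Pi.single z 1) (xB X)))
            ⬝ᵥ ((effLaplacian (L ^ n * L ^ C.scale X) (fine L (M (C.scale X))) (aK a L (C.scale X + n))
                    (((L ^ n * L ^ C.scale X : ℕ) : ℝ) ^ 2) m2
                  + (a * ((L : ℝ) ^ 2)⁻¹) • blockProj L (M (C.scale X)))⁻¹
                *ᵥ fun w => minimiser (L ^ n * L ^ C.scale X) (fine L (M (C.scale X))) (aK a L (C.scale X + n))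
                    (((L ^ n * L ^ C.scale X : ℕ) : ℝ) ^ 2) m2 (Pi.single w 1) (yB X)))
        (W : Set (ℕ → ℝ)),
        DecayBound EA W A κ ∧ DecayBound EB W A κ := by
  have hL2 : 2 ≤ L := by have := hLp.2; omega
  obtain ⟨δ₁, c₁, hδ₁, hc₁, H₁⟩ := dminimiser_row_decay d L hd hLp ha hm.le
  obtain ⟨δ₂, c₂, hδ₂, hc₂, H₂⟩ := minimiser_col_decay d L hd hLp ha hm.le
  obtain ⟨hκ'0, _⟩ := kapCT_pos_le (d := d) ha hL2
  set κ : ℝ := min (min δ₁ δ₂) (kapCT d a L) with hκ_def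
  have hκpos : 0 < κ := lt_min (lt_min hδ₁ hδ₂) hκ'0
  have hκ₁ : κ ≤ δ₁ := (min_le_left _ _).trans (min_le_left _ _)
  have hκ₂ : κ ≤ δ₂ := (min_le_left _ _).trans (min_le_right _ _)
  have hκ' : κ ≤ kapCT d a L := min_le_right _ _
  have hsC : 0 ≤ 2 / gam0L d a L := by have := gam0L_pos (d := d) ha hL2; positivity
  have hsA : 0 ≤ a * c₁ := by positivity
  have hsB : 0 ≤ a * c₂ := by positivity
  refine ⟨κ / 2, a * c₁ * (2 / gam0L d a L) * (a * c₂) * (latticeConst d (κ / 2)) ^ 2, half_pos hκpos,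
    by positivity, ?_⟩
  intro n hn M _ hM C hsc dir xA yA xB yB hx hy hdd EA EB hEA hEB W
  have hPar : ∀ (X : C.Dom) (k : ℕ), ∃ mm : ℕ, ∀ μ, fine L (M (C.scale X)) μ
      = (⟨d, L, mm, k, hd, hLp⟩ : Params).sitesPerDir k := by
    intro X k
    obtain ⟨mm, hmm⟩ := hM (C.scale X)
    exact ⟨mm, fun μ => by simp only [Params.sitesPerDir, Nat.add_sub_cancel]; exact hmm μ⟩
  -- the middle line at any level `K ≥ 1` and fineness `N` ((4.34) BY NAME, weakened from `κ′` to `κ`)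
  have hCov : ∀ (K N : ℕ) [NeZero N] (Mv : Fin d → ℕ) [∀ μ, NeZero (Mv μ)], 1 ≤ K → ∀ z w,
      |(effLaplacian N (fine L Mv) (aK a L K) (((N : ℕ) : ℝ) ^ 2) m2 + (a * ((L : ℝ) ^ 2)⁻¹) • blockProj L Mv)⁻¹ z w|
        ≤ 2 / gam0L d a L * Real.exp (-(κ * tdistT _ z w)) := by
    intro K N _ Mv _ hK z w
    obtain ⟨hlo, hhi⟩ := aminL_le_aK ha hL2 hK
    exact (king_cov_decay_torus ha hm hL2 N hlo hhi Mv z w).trans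
      (exp_decay_mono hsC hκ' ((tdistT_isPseudoDist _).nonneg z w))
  have hV : ∀ (j : ℕ) (s : Tor (fine L (M j))),
      ∑ z, Real.exp (-(κ / 2 * tdistT (fine L (M j)) s (id z))) ≤ latticeConst d (κ / 2) :=
    fun j s => tdistT_sumBound (fine L (M j)) (κ / 2) (half_pos hκpos) s
  have hN : ∀ X : C.Dom, L ^ n * L ^ C.scale X = L ^ (C.scale X + n) := fun X => by rw [pow_add, mul_comm]
  constructor
  · refine decayBound_of_threeFactorDecay (C := C) (β := fun j => Tor (fine L (M j))) (P := fun j => Tor (fine L (M j)))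
      (fun j => tdistT (fine L (M j))) (fun j => (tdistT_isPseudoDist _).nonneg)
      (fun j => (tdistT_isPseudoDist _).triangle) (fun _ => id)
      (fun X => blockOf (L ^ C.scale X) (fine L (M (C.scale X))) (xA X))
      (fun X => blockOf (L ^ C.scale X) (fine L (M (C.scale X))) (yA X))
      (fun X z => ((L ^ C.scale X : ℕ) : ℝ)
        * (minimiser (L ^ C.scale X) (fine L (M (C.scale X))) (aK a L (C.scale X))
              (((L ^ C.scale X : ℕ) : ℝ) ^ 2) m2 (Pi.single z 1)
              (xA X + unitVec (fine (L ^ C.scale X) (fine L (M (C.scale X)))) (dir X))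
            - minimiser (L ^ C.scale X) (fine L (M (C.scale X))) (aK a L (C.scale X))
              (((L ^ C.scale X : ℕ) : ℝ) ^ 2) m2 (Pi.single z 1) (xA X)))
      (fun X w => minimiser (L ^ C.scale X) (fine L (M (C.scale X))) (aK a L (C.scale X))
        (((L ^ C.scale X : ℕ) : ℝ) ^ 2) m2 (Pi.single w 1) (yA X))
      (fun X => (effLaplacian (L ^ C.scale X) (fine L (M (C.scale X))) (aK a L (C.scale X))
          (((L ^ C.scale X : ℕ) : ℝ) ^ 2) m2 + (a * ((L : ℝ) ^ 2)⁻¹) • blockProj L (M (C.scale X)))⁻¹)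
      hκpos.le hsA hsC hsB ?_ (fun X z w => hCov (C.scale X) (L ^ C.scale X) _ (hsc X) z w) ?_ hV hdd EA hEA W
    · intro X z
      obtain ⟨mm, hMK⟩ := hPar X (C.scale X)
      exact H₁ ⟨d, L, mm, C.scale X, hd, hLp⟩ rfl rfl (hsc X) (fine L (M (C.scale X))) hMK (L ^ C.scale X) rfl
        κ hκpos hκ₁ (xA X) z (dir X)
    · intro X w
      obtain ⟨mm, hMK⟩ := hPar X (C.scale X)
      exact H₂ ⟨d, L, mm, C.scale X, hd, hLp⟩ rfl rfl (hsc X) (fine L (M (C.scale X))) hMK (L ^ C.scale X) rfl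
        κ hκpos hκ₂ (yA X) w
  · refine decayBound_of_threeFactorDecay (C := C) (β := fun j => Tor (fine L (M j))) (P := fun j => Tor (fine L (M j)))
      (fun j => tdistT (fine L (M j))) (fun j => (tdistT_isPseudoDist _).nonneg)
      (fun j => (tdistT_isPseudoDist _).triangle) (fun _ => id)
      (fun X => blockOf (L ^ C.scale X) (fine L (M (C.scale X))) (xA X))
      (fun X => blockOf (L ^ C.scale X) (fine L (M (C.scale X))) (yA X))
      (fun X z => ((L ^ n * L ^ C.scale X : ℕ) : ℝ)
        * (minimiser (L ^ n * L ^ C.scale X) (fine L (M (C.scale X))) (aK a L (C.scale X + n))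
              (((L ^ n * L ^ C.scale X : ℕ) : ℝ) ^ 2) m2 (Pi.single z 1)
              (xB X + unitVec (fine (L ^ n * L ^ C.scale X) (fine L (M (C.scale X)))) (dir X))
            - minimiser (L ^ n * L ^ C.scale X) (fine L (M (C.scale X))) (aK a L (C.scale X + n))
              (((L ^ n * L ^ C.scale X : ℕ) : ℝ) ^ 2) m2 (Pi.single z 1) (xB X)))
      (fun X w => minimiser (L ^ n * L ^ C.scale X) (fine L (M (C.scale X))) (aK a L (C.scale X + n))
        (((L ^ n * L ^ C.scale X : ℕ) : ℝ) ^ 2) m2 (Pi.single w 1) (yB X))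
      (fun X => (effLaplacian (L ^ n * L ^ C.scale X) (fine L (M (C.scale X))) (aK a L (C.scale X + n))
          (((L ^ n * L ^ C.scale X : ℕ) : ℝ) ^ 2) m2 + (a * ((L : ℝ) ^ 2)⁻¹) • blockProj L (M (C.scale X)))⁻¹)
      hκpos.le hsA hsC hsB ?_
      (fun X z w => hCov (C.scale X + n) (L ^ n * L ^ C.scale X) _ (by have := hsc X; omega) z w) ?_ hV hdd EB hEB W
    · intro X z
      obtain ⟨mm, hMK⟩ := hPar X (C.scale X + n)
      have h := H₁ ⟨d, L, mm, C.scale X + n, hd, hLp⟩ rfl rfl (show 1 ≤ C.scale X + n by have := hsc X; omega)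
        (fine L (M (C.scale X))) hMK (L ^ n * L ^ C.scale X) (hN X) κ hκpos hκ₁ (xB X) z (dir X)
      rw [blockOf_over (fine L (M (C.scale X))) (xA X) (xB X) (hx X)] at h
      exact h
    · intro X w
      obtain ⟨mm, hMK⟩ := hPar X (C.scale X + n)
      have h := H₂ ⟨d, L, mm, C.scale X + n, hd, hLp⟩ rfl rfl (show 1 ≤ C.scale X + n by have := hsc X; omega)
        (fine L (M (C.scale X))) hMK (L ^ n * L ^ C.scale X) (hN X) κ hκpos hκ₂ (yB X) w
      rw [blockOf_over (fine L (M (C.scale X))) (yA X) (yB X) (hy X)] at h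
      exact h

/-! ## §2 The derivative row's full letter set: (0.25) ×2 and `NE5` at one `κ` -/

/-- **(0.25) AND `NE5` FOR THE DERIVATIVE ROW AT ONE LETTER SET** (`0 ≤ γ < 1`): `∃ κ > 0, A ≥ 0, C₅ ≥ 0` ((d, L, a, m², γ) only)
with `DecayBound EA W A κ ∧ DecayBound EB W A κ ∧ NE5 EA EB W κ (L^{−γ∕2}) C₅` for King's derivative-row graphs on p418964's binder
list (§1 + p418964 `ne5_kingModel_threeFactorDeriv_torus`, brought to the common `κ` by `decayBound_mono` ∕ `N18Knit.ne5_mono`).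
[cite: King1986, Prop. 3.9 (3.73) p.665 (second bound), Thm 3.3 (3.7) p.658, (4.42)–(4.43) p.675; Balaban1987RG1, (0.24)–(0.25) p.257, (1.18) p.263] -/
theorem kingModel_threeFactorDeriv_printedPair_torus (hd : 1 ≤ d) (L : ℕ) [NeZero L] (hLp : Odd L ∧ 1 < L) {a m2 : ℝ}
    (ha : 0 < a) (hm : 0 < m2) {γ : ℝ} (hγ0 : 0 ≤ γ) (hγ1 : γ < 1) :
    ∃ κ A C₅ : ℝ, 0 < κ ∧ 0 ≤ A ∧ 0 ≤ C₅ ∧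
      ∀ (n : ℕ) (_hn : 1 ≤ n) (M : ℕ → Fin d → ℕ) [∀ j μ, NeZero (M j μ)]
        (_hM : ∀ j, ∃ mm : ℕ, ∀ μ, L * M j μ = 2 * L ^ mm)
        (C : Carriers) (_hsc : ∀ X, 1 ≤ C.scale X) (dir : C.Dom → Fin d)
        (xA yA : (X : C.Dom) → Tor (fine (L ^ C.scale X) (fine L (M (C.scale X)))))
        (xB yB : (X : C.Dom) → Tor (fine (L ^ n * L ^ C.scale X) (fine L (M (C.scale X)))))
        (_hx : ∀ X μ, (xA X μ).val = (xB X μ).val / L ^ n)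
        (_hy : ∀ X μ, (yA X μ).val = (yB X μ).val / L ^ n)
        (_hd : ∀ X, C.d X ≤ tdistT (fine L (M (C.scale X)))
            (blockOf (L ^ C.scale X) (fine L (M (C.scale X))) (xA X))
            (blockOf (L ^ C.scale X) (fine L (M (C.scale X))) (yA X)))
        (EA : Functional C C.BgA) (EB : Functional C C.BgB)
        (_hEA : ∀ g U X, EA g U X =
          (fun z => ((L ^ C.scale X : ℕ) : ℝ)
              * (minimiser (L ^ C.scale X) (fine L (M (C.scale X))) (aK a L (C.scale X))
                    (((L ^ C.scale X : ℕ) : ℝ) ^ 2) m2 (Pi.single z 1)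
                    (xA X + unitVec (fine (L ^ C.scale X) (fine L (M (C.scale X)))) (dir X))
                  - minimiser (L ^ C.scale X) (fine L (M (C.scale X))) (aK a L (C.scale X))
                    (((L ^ C.scale X : ℕ) : ℝ) ^ 2) m2 (Pi.single z 1) (xA X)))
            ⬝ᵥ ((effLaplacian (L ^ C.scale X) (fine L (M (C.scale X))) (aK a L (C.scale X))
                    (((L ^ C.scale X : ℕ) : ℝ) ^ 2) m2
                  + (a * ((L : ℝ) ^ 2)⁻¹) • blockProj L (M (C.scale X)))⁻¹
                *ᵥ fun w => minimiser (L ^ C.scale X) (fine L (M (C.scale X))) (aK a L (C.scale X))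
                    (((L ^ C.scale X : ℕ) : ℝ) ^ 2) m2 (Pi.single w 1) (yA X)))
        (_hEB : ∀ g U X, EB g U X =
          (fun z => ((L ^ n * L ^ C.scale X : ℕ) : ℝ)
              * (minimiser (L ^ n * L ^ C.scale X) (fine L (M (C.scale X))) (aK a L (C.scale X + n))
                    (((L ^ n * L ^ C.scale X : ℕ) : ℝ) ^ 2) m2 (Pi.single z 1)
                    (xB X + unitVec (fine (L ^ n * L ^ C.scale X) (fine L (M (C.scale X)))) (dir X))
                  - minimiser (L ^ n * L ^ C.scale X) (fine L (M (C.scale X))) (aK a L (C.scale X + n))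
                    (((L ^ n * L ^ C.scale X : ℕ) : ℝ) ^ 2) m2 (Pi.single z 1) (xB X)))
            ⬝ᵥ ((effLaplacian (L ^ n * L ^ C.scale X) (fine L (M (C.scale X))) (aK a L (C.scale X + n))
                    (((L ^ n * L ^ C.scale X : ℕ) : ℝ) ^ 2) m2
                  + (a * ((L : ℝ) ^ 2)⁻¹) • blockProj L (M (C.scale X)))⁻¹
                *ᵥ fun w => minimiser (L ^ n * L ^ C.scale X) (fine L (M (C.scale X))) (aK a L (C.scale X + n))
                    (((L ^ n * L ^ C.scale X : ℕ) : ℝ) ^ 2) m2 (Pi.single w 1) (yB X)))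
        (W : Set (ℕ → ℝ)),
        DecayBound EA W A κ ∧ DecayBound EB W A κ ∧ NE5 EA EB W κ ((L : ℝ) ^ (-(γ / 2))) C₅ := by
  obtain ⟨κ₁, A, hκ₁, hA, H1⟩ := decayBound_kingModel_threeFactorDeriv_torus hd L hLp ha hm
  obtain ⟨κ₅, C₅, hκ₅, hC₅, H5⟩ := ne5_kingModel_threeFactorDeriv_torus hd L hLp ha hm hγ0 hγ1
  refine ⟨min κ₁ κ₅, A, C₅, lt_min hκ₁ hκ₅, hA, hC₅, ?_⟩
  intro n hn M _ hM C hsc dir xA yA xB yB hx hy hdd EA EB hEA hEB W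
  obtain ⟨hA1, hB1⟩ := H1 n hn M hM C hsc dir xA yA xB yB hx hy hdd EA EB hEA hEB W
  have h5 := H5 n hn M hM C hsc dir xA yA xB yB hx hy hdd EA EB hEA hEB W
  exact ⟨decayBound_mono hA1 subset_rfl (min_le_left _ _) le_rfl, decayBound_mono hB1 subset_rfl (min_le_left _ _) le_rfl,
    ne5_mono h5 subset_rfl (min_le_right _ _) (kingTheta_pos (by have := hLp.2; omega) (γ / 2)).le le_rfl hC₅ le_rfl⟩

/-! ## §3 The derivative row PER LINE, in block distance -/

/-- **KING'S ONE-RUN DECAY FOR THE DERIVATIVE-ROW GRAPHS, LINE BY LINE** (derivative twin of 5b `abs_kingGraph_le_of_readings`).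
`∃ κ > 0, A ≥ 0` ((d, L, a, m²) only) such that for every `n ≥ 1`, every family of unit tori, every index type of LINES `l` with
King scale `s_l ≥ 1`, direction `μ_l` and readings of run-A fine points under run-B fine points, and every line: both runs'
derivative-row graphs are bounded by `A·e^{−κ·|B(x_A l) − B(y_A l)|_{T₁}}` (§1 on line-indexed carriers, window `univ`).
[cite: King1986, Thm 3.3 (3.7) p.658, (4.34) p.674, (4.41)–(4.42) p.675; Balaban1987RG1, (0.25) p.257] -/
theorem abs_kingGraphDeriv_le_of_readings (hd : 1 ≤ d) (L : ℕ) [NeZero L] (hLp : Odd L ∧ 1 < L) {a m2 : ℝ}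
    (ha : 0 < a) (hm : 0 < m2) :
    ∃ κ A : ℝ, 0 < κ ∧ 0 ≤ A ∧
      ∀ (n : ℕ) (_hn : 1 ≤ n) (M : ℕ → Fin d → ℕ) [∀ k μ, NeZero (M k μ)]
        (_hM : ∀ k, ∃ mm : ℕ, ∀ μ, L * M k μ = 2 * L ^ mm)
        (ι : Type) (s : ι → ℕ) (_hs : ∀ l, 1 ≤ s l) (dir : ι → Fin d)
        (xA yA : (l : ι) → Tor (fine (L ^ s l) (fine L (M (s l)))))
        (xB yB : (l : ι) → Tor (fine (L ^ n * L ^ s l) (fine L (M (s l)))))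
        (_hx : ∀ l μ, (xA l μ).val = (xB l μ).val / L ^ n)
        (_hy : ∀ l μ, (yA l μ).val = (yB l μ).val / L ^ n) (l : ι),
        |(fun z => ((L ^ s l : ℕ) : ℝ)
              * (minimiser (L ^ s l) (fine L (M (s l))) (aK a L (s l)) (((L ^ s l : ℕ) : ℝ) ^ 2) m2 (Pi.single z 1)
                    (xA l + unitVec (fine (L ^ s l) (fine L (M (s l)))) (dir l))
                  - minimiser (L ^ s l) (fine L (M (s l))) (aK a L (s l)) (((L ^ s l : ℕ) : ℝ) ^ 2) m2 (Pi.single z 1)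
                    (xA l)))
            ⬝ᵥ ((effLaplacian (L ^ s l) (fine L (M (s l))) (aK a L (s l)) (((L ^ s l : ℕ) : ℝ) ^ 2) m2
                  + (a * ((L : ℝ) ^ 2)⁻¹) • blockProj L (M (s l)))⁻¹
                *ᵥ fun w => minimiser (L ^ s l) (fine L (M (s l))) (aK a L (s l)) (((L ^ s l : ℕ) : ℝ) ^ 2) m2
                    (Pi.single w 1) (yA l))|
            ≤ A * Real.exp (-(κ * tdistT (fine L (M (s l)))
              (blockOf (L ^ s l) (fine L (M (s l))) (xA l)) (blockOf (L ^ s l) (fine L (M (s l))) (yA l)))) ∧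
        |(fun z => ((L ^ n * L ^ s l : ℕ) : ℝ)
              * (minimiser (L ^ n * L ^ s l) (fine L (M (s l))) (aK a L (s l + n))
                    (((L ^ n * L ^ s l : ℕ) : ℝ) ^ 2) m2 (Pi.single z 1)
                    (xB l + unitVec (fine (L ^ n * L ^ s l) (fine L (M (s l)))) (dir l))
                  - minimiser (L ^ n * L ^ s l) (fine L (M (s l))) (aK a L (s l + n))
                    (((L ^ n * L ^ s l : ℕ) : ℝ) ^ 2) m2 (Pi.single z 1) (xB l)))
            ⬝ᵥ ((effLaplacian (L ^ n * L ^ s l) (fine L (M (s l))) (aK a L (s l + n))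
                    (((L ^ n * L ^ s l : ℕ) : ℝ) ^ 2) m2
                  + (a * ((L : ℝ) ^ 2)⁻¹) • blockProj L (M (s l)))⁻¹
                *ᵥ fun w => minimiser (L ^ n * L ^ s l) (fine L (M (s l))) (aK a L (s l + n))
                    (((L ^ n * L ^ s l : ℕ) : ℝ) ^ 2) m2 (Pi.single w 1) (yB l))|
            ≤ A * Real.exp (-(κ * tdistT (fine L (M (s l)))
              (blockOf (L ^ s l) (fine L (M (s l))) (xA l)) (blockOf (L ^ s l) (fine L (M (s l))) (yA l)))) := by
  obtain ⟨κ, A, hκ, hA, H⟩ := decayBound_kingModel_threeFactorDeriv_torus hd L hLp ha hm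
  refine ⟨κ, A, hκ, hA, ?_⟩
  intro n hn M _ hM ι s hs dir xA yA xB yB hx hy l
  let C' : Carriers :=
    { Dom := ι, scale := s,
      d := fun l => tdistT (fine L (M (s l))) (blockOf (L ^ s l) (fine L (M (s l))) (xA l))
        (blockOf (L ^ s l) (fine L (M (s l))) (yA l)),
      d_nonneg := fun l => tdistT_nonneg _ _ _,
      BgA := PUnit, BgB := PUnit, gauge := fun _ _ => 0, gauge_nonneg := fun _ _ => le_rfl, transport := id }
  have h := H n hn M hM C' hs dir xA yA xB yB hx hy (fun _ => le_rfl)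
    (fun _ _ l => (fun z => ((L ^ s l : ℕ) : ℝ)
        * (minimiser (L ^ s l) (fine L (M (s l))) (aK a L (s l)) (((L ^ s l : ℕ) : ℝ) ^ 2) m2 (Pi.single z 1)
              (xA l + unitVec (fine (L ^ s l) (fine L (M (s l)))) (dir l))
            - minimiser (L ^ s l) (fine L (M (s l))) (aK a L (s l)) (((L ^ s l : ℕ) : ℝ) ^ 2) m2 (Pi.single z 1)
              (xA l)))
      ⬝ᵥ ((effLaplacian (L ^ s l) (fine L (M (s l))) (aK a L (s l)) (((L ^ s l : ℕ) : ℝ) ^ 2) m2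
            + (a * ((L : ℝ) ^ 2)⁻¹) • blockProj L (M (s l)))⁻¹
          *ᵥ fun w => minimiser (L ^ s l) (fine L (M (s l))) (aK a L (s l)) (((L ^ s l : ℕ) : ℝ) ^ 2) m2
              (Pi.single w 1) (yA l)))
    (fun _ _ l => (fun z => ((L ^ n * L ^ s l : ℕ) : ℝ)
        * (minimiser (L ^ n * L ^ s l) (fine L (M (s l))) (aK a L (s l + n))
              (((L ^ n * L ^ s l : ℕ) : ℝ) ^ 2) m2 (Pi.single z 1)
              (xB l + unitVec (fine (L ^ n * L ^ s l) (fine L (M (s l)))) (dir l))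
            - minimiser (L ^ n * L ^ s l) (fine L (M (s l))) (aK a L (s l + n))
              (((L ^ n * L ^ s l : ℕ) : ℝ) ^ 2) m2 (Pi.single z 1) (xB l)))
      ⬝ᵥ ((effLaplacian (L ^ n * L ^ s l) (fine L (M (s l))) (aK a L (s l + n))
              (((L ^ n * L ^ s l : ℕ) : ℝ) ^ 2) m2
            + (a * ((L : ℝ) ^ 2)⁻¹) • blockProj L (M (s l)))⁻¹
          *ᵥ fun w => minimiser (L ^ n * L ^ s l) (fine L (M (s l))) (aK a L (s l + n))
              (((L ^ n * L ^ s l : ℕ) : ℝ) ^ 2) m2 (Pi.single w 1) (yB l)))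
    (fun _ _ _ => rfl) (fun _ _ _ => rfl) Set.univ
  exact ⟨h.1 (fun _ => 1) (Set.mem_univ _) PUnit.unit l, h.2 (fun _ => 1) (Set.mem_univ _) PUnit.unit l⟩

/-- **KING'S TWO-RUN RATE FOR THE DERIVATIVE-ROW GRAPHS, LINE BY LINE** (derivative twin of p469937 `abs_kingGraph_sub_le_of_readings`;
`0 ≤ γ < 1`): `∃ κ > 0, C₅ ≥ 0` ((d, L, a, m², γ) only — p418964's letters) with `|G^∂_A(l) − G^∂_B(l)| ≤ C₅·(L^{−γ∕2})^{s_l}·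
e^{−κ|B(x_A l) − B(y_A l)|_{T₁}}` for any index type of lines with scale, direction and readings under readings (p418964 on line-indexed
carriers). [cite: King1986, Prop. 3.9 (3.73) p.665 (second bound), Prop. 3.8 (3.71) line 2 p.664, (4.42)–(4.43) p.675] -/
theorem abs_kingGraphDeriv_sub_le_of_readings (hd : 1 ≤ d) (L : ℕ) [NeZero L] (hLp : Odd L ∧ 1 < L) {a m2 : ℝ}
    (ha : 0 < a) (hm : 0 < m2) {γ : ℝ} (hγ0 : 0 ≤ γ) (hγ1 : γ < 1) :
    ∃ κ C₅ : ℝ, 0 < κ ∧ 0 ≤ C₅ ∧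
      ∀ (n : ℕ) (_hn : 1 ≤ n) (M : ℕ → Fin d → ℕ) [∀ k μ, NeZero (M k μ)]
        (_hM : ∀ k, ∃ mm : ℕ, ∀ μ, L * M k μ = 2 * L ^ mm)
        (ι : Type) (s : ι → ℕ) (_hs : ∀ l, 1 ≤ s l) (dir : ι → Fin d)
        (xA yA : (l : ι) → Tor (fine (L ^ s l) (fine L (M (s l)))))
        (xB yB : (l : ι) → Tor (fine (L ^ n * L ^ s l) (fine L (M (s l)))))
        (_hx : ∀ l μ, (xA l μ).val = (xB l μ).val / L ^ n)
        (_hy : ∀ l μ, (yA l μ).val = (yB l μ).val / L ^ n) (l : ι),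
        |(fun z => ((L ^ s l : ℕ) : ℝ)
              * (minimiser (L ^ s l) (fine L (M (s l))) (aK a L (s l)) (((L ^ s l : ℕ) : ℝ) ^ 2) m2 (Pi.single z 1)
                    (xA l + unitVec (fine (L ^ s l) (fine L (M (s l)))) (dir l))
                  - minimiser (L ^ s l) (fine L (M (s l))) (aK a L (s l)) (((L ^ s l : ℕ) : ℝ) ^ 2) m2 (Pi.single z 1)
                    (xA l)))
            ⬝ᵥ ((effLaplacian (L ^ s l) (fine L (M (s l))) (aK a L (s l)) (((L ^ s l : ℕ) : ℝ) ^ 2) m2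
                  + (a * ((L : ℝ) ^ 2)⁻¹) • blockProj L (M (s l)))⁻¹
                *ᵥ fun w => minimiser (L ^ s l) (fine L (M (s l))) (aK a L (s l)) (((L ^ s l : ℕ) : ℝ) ^ 2) m2
                    (Pi.single w 1) (yA l))
          - (fun z => ((L ^ n * L ^ s l : ℕ) : ℝ)
              * (minimiser (L ^ n * L ^ s l) (fine L (M (s l))) (aK a L (s l + n))
                    (((L ^ n * L ^ s l : ℕ) : ℝ) ^ 2) m2 (Pi.single z 1)
                    (xB l + unitVec (fine (L ^ n * L ^ s l) (fine L (M (s l)))) (dir l))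
                  - minimiser (L ^ n * L ^ s l) (fine L (M (s l))) (aK a L (s l + n))
                    (((L ^ n * L ^ s l : ℕ) : ℝ) ^ 2) m2 (Pi.single z 1) (xB l)))
            ⬝ᵥ ((effLaplacian (L ^ n * L ^ s l) (fine L (M (s l))) (aK a L (s l + n))
                    (((L ^ n * L ^ s l : ℕ) : ℝ) ^ 2) m2
                  + (a * ((L : ℝ) ^ 2)⁻¹) • blockProj L (M (s l)))⁻¹
                *ᵥ fun w => minimiser (L ^ n * L ^ s l) (fine L (M (s l))) (aK a L (s l + n))
                    (((L ^ n * L ^ s l : ℕ) : ℝ) ^ 2) m2 (Pi.single w 1) (yB l))|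
          ≤ C₅ * ((L : ℝ) ^ (-(γ / 2))) ^ s l * Real.exp (-(κ * tdistT (fine L (M (s l)))
              (blockOf (L ^ s l) (fine L (M (s l))) (xA l)) (blockOf (L ^ s l) (fine L (M (s l))) (yA l)))) := by
  obtain ⟨κ, C₅, hκ, hC₅, H⟩ := ne5_kingModel_threeFactorDeriv_torus hd L hLp ha hm hγ0 hγ1
  refine ⟨κ, C₅, hκ, hC₅, ?_⟩
  intro n hn M _ hM ι s hs dir xA yA xB yB hx hy l
  let C' : Carriers :=
    { Dom := ι, scale := s,
      d := fun l => tdistT (fine L (M (s l))) (blockOf (L ^ s l) (fine L (M (s l))) (xA l))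
        (blockOf (L ^ s l) (fine L (M (s l))) (yA l)),
      d_nonneg := fun l => tdistT_nonneg _ _ _,
      BgA := PUnit, BgB := PUnit, gauge := fun _ _ => 0, gauge_nonneg := fun _ _ => le_rfl, transport := id }
  have h5 := H n hn M hM C' hs dir xA yA xB yB hx hy (fun _ => le_rfl)
    (fun _ _ l => (fun z => ((L ^ s l : ℕ) : ℝ)
        * (minimiser (L ^ s l) (fine L (M (s l))) (aK a L (s l)) (((L ^ s l : ℕ) : ℝ) ^ 2) m2 (Pi.single z 1)
              (xA l + unitVec (fine (L ^ s l) (fine L (M (s l)))) (dir l))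
            - minimiser (L ^ s l) (fine L (M (s l))) (aK a L (s l)) (((L ^ s l : ℕ) : ℝ) ^ 2) m2 (Pi.single z 1)
              (xA l)))
      ⬝ᵥ ((effLaplacian (L ^ s l) (fine L (M (s l))) (aK a L (s l)) (((L ^ s l : ℕ) : ℝ) ^ 2) m2
            + (a * ((L : ℝ) ^ 2)⁻¹) • blockProj L (M (s l)))⁻¹
          *ᵥ fun w => minimiser (L ^ s l) (fine L (M (s l))) (aK a L (s l)) (((L ^ s l : ℕ) : ℝ) ^ 2) m2
              (Pi.single w 1) (yA l)))
    (fun _ _ l => (fun z => ((L ^ n * L ^ s l : ℕ) : ℝ)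
        * (minimiser (L ^ n * L ^ s l) (fine L (M (s l))) (aK a L (s l + n))
              (((L ^ n * L ^ s l : ℕ) : ℝ) ^ 2) m2 (Pi.single z 1)
              (xB l + unitVec (fine (L ^ n * L ^ s l) (fine L (M (s l)))) (dir l))
            - minimiser (L ^ n * L ^ s l) (fine L (M (s l))) (aK a L (s l + n))
              (((L ^ n * L ^ s l : ℕ) : ℝ) ^ 2) m2 (Pi.single z 1) (xB l)))
      ⬝ᵥ ((effLaplacian (L ^ n * L ^ s l) (fine L (M (s l))) (aK a L (s l + n))
              (((L ^ n * L ^ s l : ℕ) : ℝ) ^ 2) m2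
            + (a * ((L : ℝ) ^ 2)⁻¹) • blockProj L (M (s l)))⁻¹
          *ᵥ fun w => minimiser (L ^ n * L ^ s l) (fine L (M (s l))) (aK a L (s l + n))
              (((L ^ n * L ^ s l : ℕ) : ℝ) ^ 2) m2 (Pi.single w 1) (yB l)))
    (fun _ _ _ => rfl) (fun _ _ _ => rfl) Set.univ
  exact h5 (fun _ => 1) (Set.mem_univ _) PUnit.unit l

end Summit.QuantumFields.YangMills.BalabanUVNodes.N18KingModelDerivOneRun

end
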